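import Summits.Ventures.HodgeRepro2.T5SU11JacobiTransform
import Summits.Ventures.HodgeRepro2.T5SU11SphericalTransformCartan
import Summits.Ventures.HodgeRepro2.T5SU11SphericalTransform

/-!
# The Jacobi transform of `cosh^{-k}` as a one-dimensional integral, and an independent cross-check of
the closed form at `λ = 4`

Two consequences of `T5SU11JacobiTransform`. (1) THE CARTAN FORM: `m_k = (1 − |g·0|²)^{k/2}` is
bi-`K`-invariant with `m_k(a_t) = cosh^{-k} t`, so by the spherical integration formula of
`T5SU11SphericalTransformCartan` (`f ∈ L¹(ν)`, `0 ≤ λ ≤ 2`)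
**`2π ∫_0^∞ cosh^{-k} t · φ_λ(a_t) · sinh t cosh t dt = 2^{k−2} √π Γ((k−1)/2)/Γ(k/2) · Γ((k−λ)/2) Γ((k+λ)/2 − 1)/Γ(k−1)`**
for `k > 2` (`integral_cosh_rpow_mul_sph_hyp`) — the Jacobi-function transform of `cosh^{-k}` in the
Cartan parameter. (2) THE CROSS-CHECK AT `λ = 4`: `φ_4(g) = 2|a(g)|² − 1` (`T5SU11SphericalLegendre`) and
`|a(g)|² = (1 − |g·0|²)⁻¹`, so `m_k φ_4 = 2 m_{k−2} − m_k` and, by the `λ = 0` values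
`∫_G m_k dν = 2π/(k − 2)`, **`∫_G m_k φ_4 dν = 2πk/((k − 2)(k − 4))`** for `k > 4`
(`integral_orbit_rpow_mul_sph_four`); comparing with the general closed form at `λ = 4` gives the Gamma
identity `2^{k−2} √π Γ((k−1)/2)/Γ(k/2) · Γ((k−4)/2) Γ(k/2 + 1)/Γ(k−1) = 2πk/((k − 2)(k − 4))`
(`gamma_value_four`) — the closed form verified at a second parameter by an independent route. The
same value is taken at `λ = −2 = 2 − 4` (`integral_orbit_rpow_mul_sph_neg_two`). (3) THE CONVOLUTION:
by the eigen-identity of `T5SU11SphericalTransform`, `∫_G m_k(h) φ_λ(h⁻¹ g) dν(h) = m̂_k(λ) φ_λ(g)` with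
`m̂_k(λ)` the closed form (`integral_orbit_rpow_mul_sph_inv_mul`, `k > 2`, `0 ≤ λ ≤ 2`). Nothing is
claimed about (N).

Blind lane: Mathlib + the HodgeRepro2 prefix only; no sorry; axioms ⊆ {propext, Classical.choice,
Quot.sound}.
-/

namespace Summit.Ventures.HodgeRepro2.T5SU11JacobiCrossCheck

open MeasureTheory MeasureTheory.Measure Metric Set Filter Topology Complex
open T5SU11Unimodular T5SU11Fibration T5SU11Cartan T5SU11OneParameter T5SU11CartanProjection
  T5HaarCircle T5BergmanCoefficient T5SU11FibrationHaar T5SU11IwasawaProjection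
  T5SU11CoeffSqCartan T5SU11SphericalFunction T5SU11SphericalSymmetry T5SU11SphericalLegendre
  T5SU11SphericalTransformCartan T5SU11SphericalTransform T5SU11JacobiIwasawa T5SU11JacobiTransform
open scoped Real

/-! ### `m_k` on `A` and its bi-`K`-invariance -/

/-- `m_k(rot u · g · rot v) = m_k(g)`. -/
lemma orbit_rpow_rot_mul_rot (k : ℝ) (u v : Circle) (g : SU11) :
    (1 - ‖orbit (rot u * g * rot v)‖ ^ 2) ^ (k / 2) = (1 - ‖orbit g‖ ^ 2) ^ (k / 2) := by
  rw [orbit_mul_rot, norm_orbit_rot_mul]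

/-- `1 − |a_t · 0|² = cosh^{-2} t`. -/
lemma one_sub_norm_orbit_sq_hyp (t : ℝ) : 1 - ‖orbit (hyp t)‖ ^ 2 = (Real.cosh t)⁻¹ ^ 2 := by
  rw [← inv_cosh_cartanT_sq, cartanT_hyp, Real.cosh_abs]

/-- `m_k(a_t) = cosh^{-k} t`. -/
lemma orbit_rpow_hyp (k t : ℝ) : (1 - ‖orbit (hyp t)‖ ^ 2) ^ (k / 2) = Real.cosh t ^ (-k) := by
  rw [one_sub_norm_orbit_sq_hyp, ← Real.rpow_two, ← Real.rpow_mul (inv_nonneg.mpr (Real.cosh_pos t).le),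
    Real.inv_rpow (Real.cosh_pos t).le, ← Real.rpow_neg (Real.cosh_pos t).le]
  congr 1
  ring

/-! ### The Cartan form of the transform and the cross-check -/

section measure

variable [MeasurableSpace Circle] [BorelSpace Circle]

/-- `m_k · φ_4 = 2 m_{k−2} − m_k` pointwise (`φ_4 = 2|a|² − 1`, `|a|² = (1 − |g·0|²)⁻¹`). -/
lemma orbit_rpow_mul_sph_four (k : ℝ) (g : SU11) :
    (1 - ‖orbit g‖ ^ 2) ^ (k / 2) * sph 4 g
      = 2 * (1 - ‖orbit g‖ ^ 2) ^ ((k - 2) / 2) - (1 - ‖orbit g‖ ^ 2) ^ (k / 2) := by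
  have hpos := one_sub_norm_orbit_sq_pos g
  have ha : ‖mat g 0 0‖ ^ 2 = (1 - ‖orbit g‖ ^ 2)⁻¹ := by
    rw [one_sub_norm_orbit_sq, inv_pow, inv_inv]
  rw [sph_four, ha, show (k - 2) / 2 = k / 2 - 1 by ring, Real.rpow_sub_one hpos.ne']
  field_simp

/-- `m_k ∈ L¹(ν)` for `k > 2` (the `λ = 0` case of `integrable_orbit_rpow_mul_exp_iwasawaT`). -/
theorem integrable_orbit_rpow {k : ℝ} (hk : 2 < k) :
    Integrable (fun g => (1 - ‖orbit g‖ ^ 2) ^ (k / 2)) (nu haarCircle) := by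
  have h := integrable_orbit_rpow_mul_exp_iwasawaT (k := k) (lam := 0) (by linarith) (by linarith)
    (by linarith)
  simpa only [zero_mul, Real.exp_zero, mul_one] using h

/-- **THE JACOBI TRANSFORM OF `cosh^{-k}` IN CARTAN COORDINATES**: for `k > 2` and `0 ≤ λ ≤ 2`,
`2π ∫_0^∞ (sinh t cosh t) · cosh^{-k} t · φ_λ(a_t) dt = 2^{k−2} √π Γ((k−1)/2)/Γ(k/2) · Γ((k−λ)/2) Γ((k+λ)/2 − 1)/Γ(k−1)`. -/
theorem integral_cosh_rpow_mul_sph_hyp {k lam : ℝ} (hk : 2 < k) (h0 : 0 ≤ lam) (h2 : lam ≤ 2) :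
    (2 * π) • ∫ t in Ioi (0 : ℝ), (Real.sinh t * Real.cosh t) • (Real.cosh t ^ (-k) * sph lam (hyp t))
      = 2 ^ (k - 2) * (√π * Real.Gamma ((k - 1) / 2) / Real.Gamma (k / 2))
          * (Real.Gamma ((k - lam) / 2) * Real.Gamma ((k + lam) / 2 - 1) / Real.Gamma (k - 1)) := by
  have h := integral_nu_mul_sph_eq_cartan h0 h2 (integrable_orbit_rpow hk)
    (fun u v g => orbit_rpow_rot_mul_rot k u v g)
  simp_rw [orbit_rpow_hyp] at h
  rw [← h]
  exact integral_orbit_rpow_mul_sph (by linarith) (by linarith) (by linarith)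

/-- **`∫_G m_k φ_4 dν = 2πk/((k − 2)(k − 4))`** for `k > 4`, by the direct route
`m_k φ_4 = 2 m_{k−2} − m_k` and the `λ = 0` values. -/
theorem integral_orbit_rpow_mul_sph_four {k : ℝ} (hk : 4 < k) :
    ∫ g, (1 - ‖orbit g‖ ^ 2) ^ (k / 2) * sph 4 g ∂(nu haarCircle)
      = 2 * π * k / ((k - 2) * (k - 4)) := by
  simp_rw [orbit_rpow_mul_sph_four]
  rw [integral_sub ((integrable_orbit_rpow (k := k - 2) (by linarith)).const_mul 2)
    (integrable_orbit_rpow (by linarith)), integral_const_mul,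
    integral_orbit_rpow_nu (k := k - 2) (by linarith), integral_orbit_rpow_nu (by linarith),
    show k - 2 - 2 = k - 4 by ring]
  have h1 : (k - 2) ≠ 0 := by linarith
  have h2 : (k - 4) ≠ 0 := by linarith
  field_simp
  ring

/-- **THE CROSS-CHECK**: the general closed form at `λ = 4` reproduces `2πk/((k − 2)(k − 4))` — a Gamma
identity obtained by comparing the two evaluations of `∫_G m_k φ_4 dν` (`k > 4`). -/
theorem gamma_value_four {k : ℝ} (hk : 4 < k) :
    2 ^ (k - 2) * (√π * Real.Gamma ((k - 1) / 2) / Real.Gamma (k / 2))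
        * (Real.Gamma ((k - 4) / 2) * Real.Gamma ((k + 4) / 2 - 1) / Real.Gamma (k - 1))
      = 2 * π * k / ((k - 2) * (k - 4)) := by
  rw [← integral_orbit_rpow_mul_sph (lam := 4) (by linarith) (by linarith) (by linarith)]
  exact integral_orbit_rpow_mul_sph_four hk

/-- The same value at `λ = −2 = 2 − 4` (`φ_{−2} = φ_4`): `∫_G m_k φ_{−2} dν = 2πk/((k − 2)(k − 4))`
for `k > 4`. -/
theorem integral_orbit_rpow_mul_sph_neg_two {k : ℝ} (hk : 4 < k) :
    ∫ g, (1 - ‖orbit g‖ ^ 2) ^ (k / 2) * sph (-2) g ∂(nu haarCircle)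
      = 2 * π * k / ((k - 2) * (k - 4)) := by
  rw [← integral_orbit_rpow_mul_sph_four hk]
  congr 1
  funext g
  rw [sph_two_sub (-2) g, show (2 : ℝ) - -2 = 4 by norm_num]

/-- The `λ = 4` value is the `λ = 0` value times `k/(k − 4)`: `∫_G m_k φ_4 dν = (k/(k − 4)) ∫_G m_k dν`
for `k > 4`. -/
theorem integral_orbit_rpow_mul_sph_four_eq_ratio {k : ℝ} (hk : 4 < k) :
    ∫ g, (1 - ‖orbit g‖ ^ 2) ^ (k / 2) * sph 4 g ∂(nu haarCircle)
      = k / (k - 4) * ∫ g, (1 - ‖orbit g‖ ^ 2) ^ (k / 2) ∂(nu haarCircle) := by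
  rw [integral_orbit_rpow_mul_sph_four hk, integral_orbit_rpow_nu (by linarith)]
  have h1 : (k - 2) ≠ 0 := by linarith
  have h2 : (k - 4) ≠ 0 := by linarith
  field_simp

/-- **The convolution of the coefficient modulus with a spherical function in closed form**: for `k > 2`
and `0 ≤ λ ≤ 2`,
`∫_G m_k(h) φ_λ(h⁻¹ g) dν(h) = [2^{k−2} √π Γ((k−1)/2)/Γ(k/2) · Γ((k−λ)/2) Γ((k+λ)/2 − 1)/Γ(k−1)] · φ_λ(g)`
(the eigen-identity of `T5SU11SphericalTransform` with the eigenvalue evaluated). -/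
theorem integral_orbit_rpow_mul_sph_inv_mul {k lam : ℝ} (hk : 2 < k) (h0 : 0 ≤ lam) (h2 : lam ≤ 2)
    (g : SU11) :
    ∫ h, (1 - ‖orbit h‖ ^ 2) ^ (k / 2) * sph lam (h⁻¹ * g) ∂(nu haarCircle)
      = (2 ^ (k - 2) * (√π * Real.Gamma ((k - 1) / 2) / Real.Gamma (k / 2))
          * (Real.Gamma ((k - lam) / 2) * Real.Gamma ((k + lam) / 2 - 1) / Real.Gamma (k - 1)))
        * sph lam g := by
  rw [integral_mul_sph_inv_mul (nu haarCircle) h0 h2 (integrable_orbit_rpow hk)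
    (fun u h => orbit_rpow_rot_mul k u h) g,
    integral_orbit_rpow_mul_sph (by linarith) (by linarith) (by linarith)]

end measure

end Summit.Ventures.HodgeRepro2.T5SU11JacobiCrossCheck
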